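import Summits.CriticalPhenomena.PercolationContinuityZ3.Theorems.PercAnnulusCrossingIICLocalConnection
import Summits.CriticalPhenomena.PercolationContinuityZ3.Theorems.PercNearOneGluingNoHeavyOneArmScales
import HarnessLib

/-!
# Uniform locality of the connections of Kesten's IIC: `ν(0 ↔ w in Λ(K‖w‖)) ≥ (1 − ε)·ν(0 ↔ w)` (lane RSW3, p1 gen 21)

builds on p205010 (kernel theorem, internal audit signed; external expert review pending) — NOT used in this file
(only `p_c(ℤ^d) > 0`).

RSW3 lane (LANE 3 `prim-rsw3`), seat `prim-rsw3-p1` (gen 21).  Helper file (`--supports stmt-CriticalPhenomena-4575`);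
no definitions, no sorries.  Memo `run/shared/lean/prim/rsw3/P1-QM.md` §34.

The splitting estimate of `…IICLocalConnection` (`ν({0 ↔ w} ∖ {0 ↔ w in Λ(b)})·π(‖w‖) ≤ C·π(b)·ν(0 ↔ w)`), the first-exit bound
`π(b) ≤ π(m)·α(m+1, b)` (gen 1, `RSW3.oneArmProb_le_mul_boxCrossing`) and uniform annulus decay UAD (`α(m, N) ≤ ε` for `N ≥ K₀m`) give:

* **`exists_iicMeasure_real_openConn_diff_le_eps_criticalProbI`** — at `p_c(ℤ^d)`, `d ≥ 2`, under (A2)□(s,L) + `CU⁺_l` + UAD: for every `ε > 0`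
  there are `K, n₀` such that for every finite measure `ν` with Kesten's IIC limit property, every `w` with `‖w‖_∞ ≥ n₀` and every `b ≥ K‖w‖_∞`:
  **`ν({0 ↔ w} ∖ {0 ↔ w in Λ(b)}) ≤ ε·ν(0 ↔ w)`**;
* **`exists_iicMeasure_real_openConnIn_ge_criticalProbI`** — equivalently **`(1 − ε)·ν(0 ↔ w) ≤ ν(0 ↔ w in Λ(b))`**: GIVEN THAT IT CONTAINS `w`, THE
  IIC JOINS `w` TO THE ROOT WITHIN DISTANCE `K‖w‖` WITH PROBABILITY `≥ 1 − ε`, UNIFORMLY IN `w` — the connections of the incipient infinite cluster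
  are LOCAL at the scale of the pair they join.
References: H. Kesten, Probab. Theory Relat. Fields 73 (1986) Thm. (8); D. Basu, A. Sapozhnikov, ECP 22 (2017) Thm. 1.1.
-/

noncomputable section

namespace Summit.CriticalPhenomena.PercolationContinuityZ3.Theorems.Crossing

open MeasureTheory Filter Topology Literature.Probability.Percolation Literature.Probability.LatticeModels
open Literature.Probability.Percolation.DCT16
open Summit.CriticalPhenomena.PercolationContinuityZ3.Theorems.SurfaceTension

variable {d : ℕ}

/-- **UNIFORM LOCALITY OF THE CONNECTIONS OF KESTEN'S IIC** (`p_c(ℤ^d)`, `d ≥ 2`; (A2)□ at aspect `(s,L)`, `2 ≤ s ≤ L`, `ϰ > 0`; `CU⁺_l(c_U)`,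
`l ≥ 2`, `c_U > 0`; UAD): for every `ε > 0` there are `K, n₀ ≥ 1` such that for every finite measure `ν` with Kesten's IIC limit property, every
site `w` with `‖w‖_∞ ≥ n₀` and every `b ≥ K‖w‖_∞`: **`ν({0 ↔ w} ∖ {0 ↔ w in Λ(b)}) ≤ ε·ν(0 ↔ w)`** (splitting estimate `≤ Cπ(b)ν(0↔w)/π(‖w‖)`,
first exit `π(b) ≤ π(‖w‖)·α(‖w‖+1, b)`, UAD `α ≤ ε/C`). [cite: Kesten1986, Thm. (8)] [cite: BasuSapozhnikov2017ECP, Thm. 1.1] -/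
theorem exists_iicMeasure_real_openConn_diff_le_eps_criticalProbI (hd : 2 ≤ d) {s L : ℕ} (hs : 2 ≤ s) (hsL : s ≤ L) {ϰ : ℝ}
    (hϰ : 0 < ϰ) (hA2 : SetToSetQuasiMultAspectAt d (criticalProbI d) s L ϰ) {l : ℕ} (hl : 2 ≤ l) {cU : ℝ} (hcU : 0 < cU)
    (hCU : ∀ a : ℕ, 1 ≤ a → ∀ E : Set (BondConfig (Site d)), IsUpperSet E → MeasurableSet E →
      cU * (bondPercolation (zdGraph d) (criticalProbI d)).real E ≤ (bondPercolation (zdGraph d) (criticalProbI d)).real (E ∩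
        {ω : BondConfig (Site d) | ∀ t ∈ innerBoundary (zdGraph d) (box d a), ∀ s ∈ innerBoundary (zdGraph d) (box d (l * a)),
          ∀ t' ∈ innerBoundary (zdGraph d) (box d a), ∀ s' ∈ innerBoundary (zdGraph d) (box d (l * a)),
          ω ∈ openConnIn (↑((box d (l * a) \ box d a) ∪ innerBoundary (zdGraph d) (box d a)) : Set (Site d)) t s →
          ω ∈ openConnIn (↑((box d (l * a) \ box d a) ∪ innerBoundary (zdGraph d) (box d a)) : Set (Site d)) t' s' →
          ω ∈ openConnIn (↑((box d (l * a) \ box d a) ∪ innerBoundary (zdGraph d) (box d a)) : Set (Site d)) s s'}))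
    (hUAD : ∀ ε : ℝ, 0 < ε → ∃ K₀ : ℕ, ∀ m : ℕ, 1 ≤ m → ∀ N : ℕ, K₀ * m ≤ N →
      (bondPercolation (zdGraph d) (criticalProbI d)).real (boxCrossing d m N) ≤ ε)
    {ε : ℝ} (hε : 0 < ε) :
    ∃ (K n₀ : ℕ), 1 ≤ K ∧ 1 ≤ n₀ ∧ ∀ (ν : Measure (BondConfig (Site d))) [IsFiniteMeasure ν],
      (∀ (F : Finset (Sym2 (Site d))) (E : Set (BondConfig (Site d))), MeasurableSet E → DeterminedBy E ↑F →
        Tendsto (fun n : ℕ => (bondPercolation (zdGraph d) (criticalProbI d)).real (E ∩ siteToBoundary d n) /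
          oneArmProb d (criticalProbI d) n) atTop (𝓝 (ν.real E))) →
      ∀ (w : Site d) (b : ℕ), n₀ ≤ Site.supNorm w → K * Site.supNorm w ≤ b →
        ν.real ((openConn (0 : Site d) w : Set (BondConfig (Site d))) \ openConnIn (↑(box d b) : Set (Site d)) 0 w) ≤
          ε * ν.real (openConn (0 : Site d) w) := by
  have hd1 : 1 ≤ d := le_trans (by norm_num) hd
  have hp : 0 < ((criticalProbI d : unitInterval) : ℝ) := by
    rw [coe_criticalProbI]; exact criticalProb_zd_pos d hd1
  have hπ : ∀ m : ℕ, 0 < oneArmProb d (criticalProbI d) m := fun m => oneArmProb_pos hd1 _ hp m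
  obtain ⟨n₀, C, hn₀, hC, hsplit⟩ := exists_iicMeasure_real_openConn_diff_le_mul_criticalProbI hd hs hsL hϰ hA2 hl hcU hCU hUAD
  obtain ⟨K₀, hK₀⟩ := hUAD (ε / C) (by positivity)
  refine ⟨2 * K₀ + 2, n₀, by omega, hn₀, fun ν _ hν w b hw hb => ?_⟩
  have hm1 : 1 ≤ Site.supNorm w := le_trans hn₀ hw
  have h2 : 2 * Site.supNorm w ≤ b := le_trans (Nat.mul_le_mul_right _ (by omega)) hb
  have hK : K₀ * (Site.supNorm w + 1) ≤ b := by
    have : K₀ * (Site.supNorm w + 1) ≤ (2 * K₀ + 2) * Site.supNorm w := by nlinarith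
    exact this.trans hb
  have hs' := hsplit ν hν w b hw h2
  -- `π(b) ≤ π(‖w‖)·α(‖w‖+1, b) ≤ π(‖w‖)·ε/C`
  have hexit := RSW3.oneArmProb_le_mul_boxCrossing (d := d) (criticalProbI d) (n := Site.supNorm w) (N := b) (by omega)
  have hα := hK₀ (Site.supNorm w + 1) (by omega) b hK
  have hπw := hπ (Site.supNorm w)
  have hν0 : 0 ≤ ν.real (openConn (0 : Site d) w) := measureReal_nonneg
  have key : ν.real ((openConn (0 : Site d) w : Set (BondConfig (Site d))) \ openConnIn (↑(box d b) : Set (Site d)) 0 w) *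
      oneArmProb d (criticalProbI d) (Site.supNorm w) ≤ ε * ν.real (openConn (0 : Site d) w) * oneArmProb d (criticalProbI d) (Site.supNorm w) :=
    calc ν.real ((openConn (0 : Site d) w : Set (BondConfig (Site d))) \ openConnIn (↑(box d b) : Set (Site d)) 0 w) *
          oneArmProb d (criticalProbI d) (Site.supNorm w)
        ≤ C * oneArmProb d (criticalProbI d) b * ν.real (openConn (0 : Site d) w) := hs'
      _ ≤ C * (oneArmProb d (criticalProbI d) (Site.supNorm w) *
            (bondPercolation (zdGraph d) (criticalProbI d)).real (boxCrossing d (Site.supNorm w + 1) b)) * ν.real (openConn (0 : Site d) w) :=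
          mul_le_mul_of_nonneg_right (mul_le_mul_of_nonneg_left hexit hC.le) hν0
      _ ≤ C * (oneArmProb d (criticalProbI d) (Site.supNorm w) * (ε / C)) * ν.real (openConn (0 : Site d) w) :=
          mul_le_mul_of_nonneg_right (mul_le_mul_of_nonneg_left (mul_le_mul_of_nonneg_left hα hπw.le) hC.le) hν0
      _ = ε * ν.real (openConn (0 : Site d) w) * oneArmProb d (criticalProbI d) (Site.supNorm w) := by field_simp
  exact le_of_mul_le_mul_right key hπw

/-- **GIVEN THAT IT CONTAINS `w`, THE IIC JOINS `w` TO THE ROOT WITHIN DISTANCE `K‖w‖` WITH PROBABILITY `≥ 1 − ε`** (hypotheses of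
`exists_iicMeasure_real_openConn_diff_le_eps_criticalProbI`): for every `ε > 0` there are `K, n₀ ≥ 1` with
**`(1 − ε)·ν(0 ↔ w) ≤ ν(0 ↔ w in Λ(b))`** for every finite measure `ν` with Kesten's IIC limit property, every `‖w‖_∞ ≥ n₀` and every `b ≥ K‖w‖_∞`.
[cite: Kesten1986, Thm. (8)] [cite: BasuSapozhnikov2017ECP, Thm. 1.1] -/
theorem exists_iicMeasure_real_openConnIn_ge_criticalProbI (hd : 2 ≤ d) {s L : ℕ} (hs : 2 ≤ s) (hsL : s ≤ L) {ϰ : ℝ}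
    (hϰ : 0 < ϰ) (hA2 : SetToSetQuasiMultAspectAt d (criticalProbI d) s L ϰ) {l : ℕ} (hl : 2 ≤ l) {cU : ℝ} (hcU : 0 < cU)
    (hCU : ∀ a : ℕ, 1 ≤ a → ∀ E : Set (BondConfig (Site d)), IsUpperSet E → MeasurableSet E →
      cU * (bondPercolation (zdGraph d) (criticalProbI d)).real E ≤ (bondPercolation (zdGraph d) (criticalProbI d)).real (E ∩
        {ω : BondConfig (Site d) | ∀ t ∈ innerBoundary (zdGraph d) (box d a), ∀ s ∈ innerBoundary (zdGraph d) (box d (l * a)),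
          ∀ t' ∈ innerBoundary (zdGraph d) (box d a), ∀ s' ∈ innerBoundary (zdGraph d) (box d (l * a)),
          ω ∈ openConnIn (↑((box d (l * a) \ box d a) ∪ innerBoundary (zdGraph d) (box d a)) : Set (Site d)) t s →
          ω ∈ openConnIn (↑((box d (l * a) \ box d a) ∪ innerBoundary (zdGraph d) (box d a)) : Set (Site d)) t' s' →
          ω ∈ openConnIn (↑((box d (l * a) \ box d a) ∪ innerBoundary (zdGraph d) (box d a)) : Set (Site d)) s s'}))
    (hUAD : ∀ ε : ℝ, 0 < ε → ∃ K₀ : ℕ, ∀ m : ℕ, 1 ≤ m → ∀ N : ℕ, K₀ * m ≤ N →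
      (bondPercolation (zdGraph d) (criticalProbI d)).real (boxCrossing d m N) ≤ ε)
    {ε : ℝ} (hε : 0 < ε) :
    ∃ (K n₀ : ℕ), 1 ≤ K ∧ 1 ≤ n₀ ∧ ∀ (ν : Measure (BondConfig (Site d))) [IsFiniteMeasure ν],
      (∀ (F : Finset (Sym2 (Site d))) (E : Set (BondConfig (Site d))), MeasurableSet E → DeterminedBy E ↑F →
        Tendsto (fun n : ℕ => (bondPercolation (zdGraph d) (criticalProbI d)).real (E ∩ siteToBoundary d n) /
          oneArmProb d (criticalProbI d) n) atTop (𝓝 (ν.real E))) →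
      ∀ (w : Site d) (b : ℕ), n₀ ≤ Site.supNorm w → K * Site.supNorm w ≤ b →
        (1 - ε) * ν.real (openConn (0 : Site d) w) ≤ ν.real (openConnIn (↑(box d b) : Set (Site d)) (0 : Site d) w) := by
  obtain ⟨K, n₀, hK, hn₀, h⟩ := exists_iicMeasure_real_openConn_diff_le_eps_criticalProbI hd hs hsL hϰ hA2 hl hcU hCU hUAD hε
  refine ⟨K, n₀, hK, hn₀, fun ν _ hν w b hw hb => ?_⟩
  have hdiff := h ν hν w b hw hb
  have hsub : (openConnIn (↑(box d b) : Set (Site d)) (0 : Site d) w : Set (BondConfig (Site d))) ⊆ openConn (0 : Site d) w := by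
    rw [Literature.Barriers.CriticalPhenomena.openConn_zero_eq_iUnion_openConnIn w]
    exact Set.subset_iUnion (fun m : ℕ => (openConnIn (↑(box d m) : Set (Site d)) (0 : Site d) w : Set (BondConfig (Site d)))) b
  have hsplit : ν.real (openConn (0 : Site d) w) =
      ν.real (openConnIn (↑(box d b) : Set (Site d)) (0 : Site d) w) +
        ν.real ((openConn (0 : Site d) w : Set (BondConfig (Site d))) \ openConnIn (↑(box d b) : Set (Site d)) 0 w) := by
    rw [← measureReal_union Set.disjoint_sdiff_right ((measurableSet_openConn_holds 0 w).diff (measurableSet_openConnIn (box d b) 0 w)),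
      Set.union_sdiff_cancel hsub]
  nlinarith [hsplit, hdiff, (measureReal_nonneg : 0 ≤ ν.real (openConn (0 : Site d) w))]

end Summit.CriticalPhenomena.PercolationContinuityZ3.Theorems.Crossing

end
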